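import Mathlib
import Summits.MatrixMultiplication.MatrixMultiplication.Theorems.FidelityWitnessesFidelityGapThreeSeventeenPunctualDefs

/-!
# `FidelityGapThreeSeventeen` (stmt-MatrixMultiplication-4958), line `punctual-saturation`, stub N —
# part 1: weight extraction under the torus of the Borel group

Helper file for the registered stub `stub_noSaturatedCandidate` (no Borel-stable punctual candidate
ideal of border apolarity for `(⟨3,3,3⟩, 17)` is saturated), vocabulary of
`FidelityWitnessesFidelityGapThreeSeventeenPunctualDefs` (`Var`, `S`, `wt`, `SD`, `borelVar`,
`borelSubst`, `IsBorelStable`, …; slot `1 = A` with index `(κ,μ)`, slot `2 = B` with index `(μ,ν)`).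

Content (all elementary):
* diagonal substitutions `(P,Q,R) = (diag p, diag q, diag r)` are Borel (`isUpperUnit_diagonal`) and
  rescale the variables, so the `(0,1,1)`-monomials `a_{κμ} b_{μ'ν}` are eigenvectors with character
  `p_κ q_μ q_{μ'}⁻¹ r_ν` (`borelSubst_diagonal_monomial`);
* classification of the `(0,1,1)`-monomials (`exists_eq_mAB_of_weight_eq`) and the expansion of a
  `(0,1,1)`-form in them (`eq_sum_coeff_smul_monomial`);
* for the torus element `(diag 2^κ, diag 2^{16 e_μ}, diag 2^{4ν})`, `e = (0,1,3)`, the character of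
  `a_{κμ} b_{μ'ν}` with `μ ≠ μ'` is not shared by any other `(0,1,1)`-monomial (`chi_injective`);
* **weight extraction** (`coeff_smul_monomial_mem`, registered as `stub_noSaturatedCandidate_torus`):
  if `I` is Borel-stable and `f ∈ I` is a `(0,1,1)`-form, the term of `f` on every `a_{κμ} b_{μ'ν}`
  with `μ ≠ μ'` lies in `I` — Lagrange interpolation `∏_{χ' ≠ χ} (φ - χ')` in that one substitution
  `φ`, which preserves `I`.

No new definitions: the exponent vector `mAB b c` of `a_b · b_c` enters through a defining hypothesis `hm`. Source of the argument: standard torus-weight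
decomposition of a `T`-stable subspace (e.g. Conner–Harper–Landsberg 2023 §2.3 for the Borel-fixed
setting of border apolarity).
-/

noncomputable section

namespace Summit.MatrixMultiplication.MatrixMultiplication.Theorems.PunctualSaturation

-- single-conjunct summit: the `Summit.<S>.<P>` prefix repeats `MatrixMultiplication` by design (D-0017)
set_option linter.dupNamespace false

open scoped BigOperators
open MvPolynomial

namespace NoSat

/-! ## Diagonal (torus) substitutions -/

/-- A diagonal matrix with non-zero entries is upper triangular and invertible. -/
theorem isUpperUnit_diagonal (d : Fin 3 → ℂ) (hd : ∀ i, d i ≠ 0) :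
    IsUpperUnit (Matrix.diagonal d) := by
  refine ⟨fun i j hij => Matrix.diagonal_apply_ne d (ne_of_gt hij), ?_⟩
  rw [Matrix.det_diagonal]
  exact isUnit_iff_ne_zero.mpr (Finset.prod_ne_zero_iff.mpr fun i _ => hd i)

/-- The inverse of an invertible diagonal matrix. -/
theorem inv_diagonal_eq (d : Fin 3 → ℂ) (hd : ∀ i, d i ≠ 0) :
    (Matrix.diagonal d)⁻¹ = Matrix.diagonal fun i => (d i)⁻¹ := by
  apply Matrix.inv_eq_left_inv
  rw [Matrix.diagonal_mul_diagonal, ← Matrix.diagonal_one]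
  congr 1
  funext i
  exact inv_mul_cancel₀ (hd i)

/-- A diagonal substitution rescales the `A`-variables: `a_{κμ} ↦ p_κ q_μ a_{κμ}`. -/
theorem borelVar_diagonal_A (p q r : Fin 3 → ℂ) (b : Fin 3 × Fin 3) :
    borelVar (Matrix.diagonal p) (Matrix.diagonal q) (Matrix.diagonal r) ((1 : Fin 3), b) =
      C (p b.1 * q b.2) * X (((1 : Fin 3), b) : Var) := by
  simp only [borelVar, Matrix.cons_val_one]
  rw [Finset.sum_eq_single b.1, Finset.sum_eq_single b.2]
  · simp [Matrix.diagonal_apply_eq]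
  · intro j _ hj
    simp [Matrix.diagonal_apply_ne _ hj]
  · simp
  · intro i _ hi
    simp [Matrix.diagonal_apply_ne' _ hi]
  · simp

/-- A diagonal substitution rescales the `B`-variables: `b_{μν} ↦ q_μ⁻¹ r_ν b_{μν}`. -/
theorem borelVar_diagonal_B (p q r : Fin 3 → ℂ) (hq : ∀ i, q i ≠ 0) (c : Fin 3 × Fin 3) :
    borelVar (Matrix.diagonal p) (Matrix.diagonal q) (Matrix.diagonal r) ((2 : Fin 3), c) =
      C ((q c.1)⁻¹ * r c.2) * X (((2 : Fin 3), c) : Var) := by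
  simp only [borelVar, Matrix.cons_val_two, Matrix.tail_cons, Matrix.head_cons,
    inv_diagonal_eq q hq]
  rw [Finset.sum_eq_single c.1, Finset.sum_eq_single c.2]
  · simp [Matrix.diagonal_apply_eq]
  · intro j _ hj
    simp [Matrix.diagonal_apply_ne _ hj]
  · simp
  · intro i _ hi
    simp [Matrix.diagonal_apply_ne _ (Ne.symm hi)]
  · simp

/-- An ideal stable under an algebra endomorphism `φ` is stable under every polynomial in `φ`. -/
theorem aeval_toLinearMap_apply_mem {I : Ideal S} {φ : S →ₐ[ℂ] S} (hφ : ∀ f ∈ I, φ f ∈ I)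
    (P : Polynomial ℂ) {f : S} (hf : f ∈ I) :
    Polynomial.aeval φ.toLinearMap P f ∈ I := by
  induction P using Polynomial.induction_on' with
  | add p q hp hq =>
    rw [map_add, LinearMap.add_apply]
    exact I.add_mem hp hq
  | monomial n a =>
    rw [Polynomial.aeval_monomial, Module.End.mul_apply, Module.algebraMap_end_apply,
      Module.End.pow_apply]
    refine Submodule.smul_of_tower_mem I a ?_
    induction n with
    | zero => simpa using hf
    | succ n ih =>
      rw [Function.iterate_succ_apply']
      exact hφ _ ih

/-- **Uniqueness of the torus character** `2^κ · 2^{16 e_μ} · 2^{-16 e_{μ'}} · 2^{4ν}` (`e = (0,1,3)`)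
of `a_{κμ} b_{μ'ν}` for `μ ≠ μ'` among the `(0,1,1)`-monomials. -/
theorem chi_injective {b c b' c' : Fin 3 × Fin 3} (hbc : b.2 ≠ c.1)
    (h : (2 : ℂ) ^ (b'.1.val + 16 * (![0, 1, 3] : Fin 3 → ℕ) b'.2) *
        (((2 : ℂ) ^ (16 * (![0, 1, 3] : Fin 3 → ℕ) c'.1))⁻¹ * (2 : ℂ) ^ (4 * c'.2.val)) =
      (2 : ℂ) ^ (b.1.val + 16 * (![0, 1, 3] : Fin 3 → ℕ) b.2) *
        (((2 : ℂ) ^ (16 * (![0, 1, 3] : Fin 3 → ℕ) c.1))⁻¹ * (2 : ℂ) ^ (4 * c.2.val))) :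
    b' = b ∧ c' = c := by
  -- clear denominators and compare exponents
  have key : (2 : ℂ) ^ (b'.1.val + 16 * (![0, 1, 3] : Fin 3 → ℕ) b'.2 + 4 * c'.2.val +
      16 * (![0, 1, 3] : Fin 3 → ℕ) c.1) =
      (2 : ℂ) ^ (b.1.val + 16 * (![0, 1, 3] : Fin 3 → ℕ) b.2 + 4 * c.2.val +
      16 * (![0, 1, 3] : Fin 3 → ℕ) c'.1) := by
    have := congrArg (fun z => z * ((2 : ℂ) ^ (16 * (![0, 1, 3] : Fin 3 → ℕ) c'.1) *
      (2 : ℂ) ^ (16 * (![0, 1, 3] : Fin 3 → ℕ) c.1))) h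
    field_simp at this
    simp only [pow_add]
    linear_combination this
  have hN := Nat.pow_right_injective (le_refl 2) (by exact_mod_cast key)
  have hdec : ∀ μ μ' μ₁ μ₁' : Fin 3, μ ≠ μ' →
      (![0, 1, 3] : Fin 3 → ℕ) μ + (![0, 1, 3] : Fin 3 → ℕ) μ₁' =
        (![0, 1, 3] : Fin 3 → ℕ) μ₁ + (![0, 1, 3] : Fin 3 → ℕ) μ' → μ₁ = μ ∧ μ₁' = μ' := by
    decide
  have hb1 : b'.1 = b.1 := Fin.ext (by omega)
  have hc2 : c'.2 = c.2 := Fin.ext (by omega)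
  obtain ⟨hb2, hc1⟩ := hdec b.2 c.1 b'.2 c'.1 hbc (by omega)
  exact ⟨Prod.ext hb1 hb2, Prod.ext hc1 hc2⟩

/-! ## The monomials `a_b · b_c` of multidegree `(0,1,1)`

From here on `mAB b c` denotes the exponent vector of `a_b · b_c`, introduced through the defining
hypothesis `hm` (no definition is added to the vocabulary). -/

variable {mAB : Fin 3 × Fin 3 → Fin 3 × Fin 3 → Var →₀ ℕ}

/-- `a_b · b_c` as a product of variables. -/
theorem X_mul_X_eq (hm : ∀ b c, mAB b c = Finsupp.single (1, b) 1 + Finsupp.single (2, c) 1)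
    (b c : Fin 3 × Fin 3) :
    (X (((1 : Fin 3), b) : Var) * X (((2 : Fin 3), c) : Var) : S) = monomial (mAB b c) 1 := by
  rw [hm, X, X, monomial_mul, one_mul]

/-- The monomials `a_b · b_c` are eigenvectors of a diagonal substitution, with character
`p_{b.1} q_{b.2} q_{c.1}⁻¹ r_{c.2}`. -/
theorem borelSubst_diagonal_monomial
    (hm : ∀ b c, mAB b c = Finsupp.single (1, b) 1 + Finsupp.single (2, c) 1)
    (p q r : Fin 3 → ℂ) (hq : ∀ i, q i ≠ 0) (b c : Fin 3 × Fin 3) :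
    borelSubst (Matrix.diagonal p) (Matrix.diagonal q) (Matrix.diagonal r) (monomial (mAB b c) 1) =
      (p b.1 * q b.2 * ((q c.1)⁻¹ * r c.2)) • (monomial (mAB b c) 1 : S) := by
  rw [← X_mul_X_eq hm, map_mul, borelSubst, aeval_X, aeval_X, borelVar_diagonal_A,
    borelVar_diagonal_B p q r hq, smul_eq_C_mul]
  simp only [map_mul]
  ring

/-- The `l`-th coordinate of the multidegree of an exponent vector is its total degree in the
slot-`l` variables. -/
theorem weight_wt_apply_eq_sum (m : Var →₀ ℕ) (l : Fin 3) :
    Finsupp.weight wt m l = ∑ x : Fin 3 × Fin 3, m (l, x) := by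
  classical
  rw [Finsupp.weight_apply, Finsupp.sum_fintype _ _ (fun _ => by simp), Finset.sum_apply,
    Fintype.sum_prod_type]
  simp only [wt, Pi.smul_apply, Pi.single_apply, smul_eq_mul, mul_ite, mul_one, mul_zero]
  rw [Finset.sum_comm]
  simp

/-- A sum of natural numbers over a finite type equals `1` only if exactly one term is `1`. -/
theorem eq_ite_of_sum_eq_one {α : Type*} [Fintype α] [DecidableEq α] (g : α → ℕ)
    (h : ∑ x, g x = 1) : ∃ x₀, ∀ x, g x = if x = x₀ then 1 else 0 := by
  obtain ⟨x₀, -, hx₀⟩ : ∃ x₀ ∈ (Finset.univ : Finset α), g x₀ ≠ 0 :=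
    Finset.exists_ne_zero_of_sum_ne_zero (by omega)
  have hsplit := Finset.add_sum_erase (Finset.univ : Finset α) g (Finset.mem_univ x₀)
  have hle : g x₀ ≤ 1 := by
    have := Finset.single_le_sum (f := g) (fun _ _ => Nat.zero_le _) (Finset.mem_univ x₀)
    omega
  have hrest : ∑ x ∈ Finset.univ.erase x₀, g x = 0 := by omega
  refine ⟨x₀, fun x => ?_⟩
  split_ifs with hx
  · subst hx; omega
  · exact (Finset.sum_eq_zero_iff.mp hrest) x (Finset.mem_erase.mpr ⟨hx, Finset.mem_univ x⟩)

/-- **Classification of the `(0,1,1)`-monomials**: they are the `81` products `a_b · b_c`. -/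
theorem exists_eq_mAB_of_weight_eq
    (hm : ∀ b c, mAB b c = Finsupp.single (1, b) 1 + Finsupp.single (2, c) 1)
    {m : Var →₀ ℕ} (hw : Finsupp.weight wt m = ![0, 1, 1]) : ∃ b c : Fin 3 × Fin 3, m = mAB b c := by
  classical
  have hrow : ∀ l : Fin 3, ∑ x : Fin 3 × Fin 3, m (l, x) = (![0, 1, 1] : Fin 3 → ℕ) l := fun l => by
    rw [← weight_wt_apply_eq_sum, hw]
  have h0 : ∀ x : Fin 3 × Fin 3, m (0, x) = 0 := fun x =>
    (Finset.sum_eq_zero_iff.mp ((hrow 0).trans (by simp))) x (Finset.mem_univ x)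
  obtain ⟨b, hb⟩ := eq_ite_of_sum_eq_one (fun x => m (1, x)) ((hrow 1).trans (by simp))
  obtain ⟨c, hc⟩ := eq_ite_of_sum_eq_one (fun x => m (2, x)) ((hrow 2).trans (by simp))
  refine ⟨b, c, ?_⟩
  rw [hm]
  refine Finsupp.ext fun v => ?_
  obtain ⟨s, x⟩ := v
  fin_cases s
  · simp [h0 x]
  · simp [hb x, Finsupp.single_apply, eq_comm]
  · simp [hc x, Finsupp.single_apply, eq_comm]

/-- `(b, c) ↦ a_b · b_c` is injective on exponent vectors. -/
theorem mAB_injective (hm : ∀ b c, mAB b c = Finsupp.single (1, b) 1 + Finsupp.single (2, c) 1)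
    {b c b' c' : Fin 3 × Fin 3} (h : mAB b c = mAB b' c') : b = b' ∧ c = c' := by
  classical
  rw [hm, hm] at h
  have h1 := DFunLike.congr_fun h ((1 : Fin 3), b)
  have h2 := DFunLike.congr_fun h ((2 : Fin 3), c)
  simp only [Finsupp.coe_add, Pi.add_apply, Finsupp.single_apply, Prod.mk.injEq] at h1 h2
  constructor
  · by_contra hb
    simp [Ne.symm hb] at h1
  · by_contra hc
    simp [Ne.symm hc] at h2

/-- `a_b · b_c` has multidegree `(0,1,1)`. -/
theorem monomial_mAB_mem (hm : ∀ b c, mAB b c = Finsupp.single (1, b) 1 + Finsupp.single (2, c) 1)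
    (b c : Fin 3 × Fin 3) : (monomial (mAB b c) (1 : ℂ) : S) ∈ SD ![0, 1, 1] := by
  rw [mem_weightedHomogeneousSubmodule]
  refine isWeightedHomogeneous_monomial _ _ _ ?_
  rw [hm, map_add, Finsupp.weight_single, Finsupp.weight_single]
  funext l
  fin_cases l <;> simp [wt]

/-- A `(0,1,1)`-form is the sum of its `81` monomial terms. -/
theorem eq_sum_coeff_smul_monomial
    (hm : ∀ b c, mAB b c = Finsupp.single (1, b) 1 + Finsupp.single (2, c) 1)
    {f : S} (hD : f ∈ SD ![0, 1, 1]) :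
    f = ∑ bc : (Fin 3 × Fin 3) × (Fin 3 × Fin 3),
      coeff (mAB bc.1 bc.2) f • (monomial (mAB bc.1 bc.2) (1 : ℂ) : S) := by
  classical
  rw [mem_weightedHomogeneousSubmodule] at hD
  have hsupp : f.support ⊆ (Finset.univ.image
      fun bc : (Fin 3 × Fin 3) × (Fin 3 × Fin 3) => mAB bc.1 bc.2) := by
    intro m hmem
    obtain ⟨b, c, rfl⟩ := exists_eq_mAB_of_weight_eq hm (hD (mem_support_iff.mp hmem))
    exact Finset.mem_image.mpr ⟨(b, c), Finset.mem_univ _, rfl⟩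
  have hinj : Set.InjOn (fun bc : (Fin 3 × Fin 3) × (Fin 3 × Fin 3) => mAB bc.1 bc.2)
      ↑(Finset.univ : Finset ((Fin 3 × Fin 3) × (Fin 3 × Fin 3))) := by
    intro x _ y _ hxy
    obtain ⟨h1, h2⟩ := mAB_injective hm hxy
    exact Prod.ext h1 h2
  rw [← Finset.sum_image (f := fun m => coeff m f • (monomial m (1 : ℂ) : S)) hinj]
  rw [← Finset.sum_subset hsupp]
  · conv_lhs => rw [f.as_sum]
    refine Finset.sum_congr rfl fun m _ => ?_
    rw [smul_monomial, smul_eq_mul, mul_one]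
  · intro m _ hmem
    rw [notMem_support_iff.mp hmem, zero_smul]

/-! ## Weight extraction -/

/-- **Weight extraction.** If `I` is Borel-stable and `f ∈ I` is a `(0,1,1)`-form then the term of
`f` on each monomial `a_{κμ} b_{μ'ν}` with `μ ≠ μ'` lies in `I`: Lagrange interpolation
`∏_{χ' ≠ χ} (φ - χ')` in the one diagonal substitution `φ = (diag 2^κ, diag 2^{16 e_μ}, diag 2^{4ν})`,
whose character `χ` isolates that monomial (`chi_injective`) and which preserves `I`. -/
theorem coeff_smul_monomial_mem
    (hm : ∀ b c, mAB b c = Finsupp.single (1, b) 1 + Finsupp.single (2, c) 1)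
    {I : Ideal S} (hB : IsBorelStable I) {f : S} (hf : f ∈ I)
    (hD : f ∈ SD ![0, 1, 1]) (b c : Fin 3 × Fin 3) (hbc : b.2 ≠ c.1) :
    coeff (mAB b c) f • (monomial (mAB b c) (1 : ℂ) : S) ∈ I := by
  classical
  -- the diagonal substitution and its characters
  set p : Fin 3 → ℂ := fun κ => (2 : ℂ) ^ κ.val with hp
  set q : Fin 3 → ℂ := fun μ => (2 : ℂ) ^ (16 * (![0, 1, 3] : Fin 3 → ℕ) μ) with hq
  set r : Fin 3 → ℂ := fun ν => (2 : ℂ) ^ (4 * ν.val) with hr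
  set χ : (Fin 3 × Fin 3) × (Fin 3 × Fin 3) → ℂ := fun bc =>
    (2 : ℂ) ^ (bc.1.1.val + 16 * (![0, 1, 3] : Fin 3 → ℕ) bc.1.2) *
      (((2 : ℂ) ^ (16 * (![0, 1, 3] : Fin 3 → ℕ) bc.2.1))⁻¹ * (2 : ℂ) ^ (4 * bc.2.2.val)) with hχ
  have h2 : ∀ n : ℕ, (2 : ℂ) ^ n ≠ 0 := fun n => pow_ne_zero n two_ne_zero
  set φ : S →ₐ[ℂ] S := borelSubst (Matrix.diagonal p) (Matrix.diagonal q) (Matrix.diagonal r)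
    with hφ
  have hφI : ∀ g ∈ I, φ g ∈ I := hB _ _ _ (isUpperUnit_diagonal p fun i => h2 _)
    (isUpperUnit_diagonal q fun i => h2 _) (isUpperUnit_diagonal r fun i => h2 _)
  have hφm : ∀ bc : (Fin 3 × Fin 3) × (Fin 3 × Fin 3),
      φ.toLinearMap (monomial (mAB bc.1 bc.2) 1) = χ bc • (monomial (mAB bc.1 bc.2) 1 : S) := by
    intro bc
    rw [AlgHom.toLinearMap_apply, hφ, borelSubst_diagonal_monomial hm p q r (fun i => h2 _)]
    simp only [hp, hq, hr, hχ, pow_add]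
  -- the interpolation polynomial vanishing at all other characters
  set P : Polynomial ℂ := ∏ bc ∈ Finset.univ.erase (b, c), (Polynomial.X - Polynomial.C (χ bc))
    with hP
  have hPeval : ∀ bc : (Fin 3 × Fin 3) × (Fin 3 × Fin 3), bc ≠ (b, c) → P.eval (χ bc) = 0 := by
    intro bc hbc'
    rw [hP, Polynomial.eval_prod]
    exact Finset.prod_eq_zero (Finset.mem_erase.mpr ⟨hbc', Finset.mem_univ _⟩) (by simp)
  have hPne : P.eval (χ (b, c)) ≠ 0 := by
    rw [hP, Polynomial.eval_prod, Finset.prod_ne_zero_iff]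
    intro bc hbc'
    simp only [Polynomial.eval_sub, Polynomial.eval_X, Polynomial.eval_C, sub_ne_zero]
    intro h
    have h' := h.symm
    simp only [hχ] at h'
    obtain ⟨h1, h2⟩ := chi_injective hbc h'
    exact (Finset.mem_erase.mp hbc').1 (Prod.ext h1 h2)
  -- apply `P(φ)` to `f`
  have hmem : Polynomial.aeval φ.toLinearMap P f ∈ I := aeval_toLinearMap_apply_mem hφI P hf
  have hcalc : Polynomial.aeval φ.toLinearMap P f =
      (P.eval (χ (b, c)) * coeff (mAB b c) f) • (monomial (mAB b c) (1 : ℂ) : S) := by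
    conv_lhs => rw [eq_sum_coeff_smul_monomial hm hD]
    rw [map_sum, Finset.sum_eq_single (b, c)]
    · rw [LinearMap.map_smul_of_tower, Module.End.aeval_apply_of_mem_apply_eq_smul (hφm (b, c)),
        smul_smul, mul_comm]
    · intro bc _ hbc'
      rw [LinearMap.map_smul_of_tower, Module.End.aeval_apply_of_mem_apply_eq_smul (hφm bc),
        hPeval bc hbc', zero_smul, smul_zero]
    · intro h
      exact absurd (Finset.mem_univ _) h
  rw [hcalc] at hmem
  have := Submodule.smul_of_tower_mem I (P.eval (χ (b, c)))⁻¹ hmem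
  rwa [smul_smul, ← mul_assoc, inv_mul_cancel₀ hPne, one_mul] at this

end NoSat

/-- **Registered helper stub `stub_noSaturatedCandidate_torus` (weight extraction).** If `I` is
Borel-stable and `f ∈ I` has multidegree `(0,1,1)`, then for every monomial `a_b · b_c` with
`b.2 ≠ c.1` the term `coeff(a_b b_c) f · a_b b_c` lies in `I`. -/
theorem stub_noSaturatedCandidate_torus : ∀ I : Ideal S, IsBorelStable I → ∀ f ∈ I,
    f ∈ SD (Pi.single 1 1 + Pi.single 2 1 : Fin 3 → ℕ) → ∀ b c : Fin 3 × Fin 3, b.2 ≠ c.1 →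
    MvPolynomial.coeff (Finsupp.single ((1 : Fin 3), b) 1 + Finsupp.single ((2 : Fin 3), c) 1) f •
      (MvPolynomial.monomial (Finsupp.single ((1 : Fin 3), b) 1 + Finsupp.single ((2 : Fin 3), c) 1)
        (1 : ℂ) : S) ∈ I := by
  intro I hB f hf hD b c hbc
  have h011 : (Pi.single 1 1 + Pi.single 2 1 : Fin 3 → ℕ) = ![0, 1, 1] := by
    funext l
    fin_cases l <;> simp
  rw [h011] at hD
  exact NoSat.coeff_smul_monomial_mem
    (mAB := fun b c => Finsupp.single (1, b) 1 + Finsupp.single (2, c) 1) (fun _ _ => rfl)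
    hB hf hD b c hbc

end Summit.MatrixMultiplication.MatrixMultiplication.Theorems.PunctualSaturation

end
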